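import Mathlib
import Summits.MatrixMultiplication.Statement
import Summits.MatrixMultiplication.MatrixMultiplication.Theorems.GraphEquationsTowerAssembly
import Summits.MatrixMultiplication.MatrixMultiplication.Theorems.GraphEquationsNullExp

/-!
# Graph equations — THE GROWTH DIAL: read-out multipliers, the uniform tower bound, and the hand
# in exponent-growth currency (M23a, decomp-mm-lens-5 g36)

(supports `MultiplicityReduction`, stmt-MatrixMultiplication-27806.  No new definition.)

M21d certified `ω = 2 ⟺ V ∧ GH(m) ∧ FR(m)` and M22d `FR(m) ⟸ S1(m)` with the constant hidden in an
`∃ C`.  Here the dial is spelled out with a READ-OUT MULTIPLIER `φ : ℕ → ℕ` (binders, no `def`):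
`ReadOut φ m` — every family `t ⊆ 𝕀(W_n)` free over a nonscalar sequence of length `≤ N` with
`f_q^m ∈ (t)` gives `R(⟨n,n,n⟩) ≤ φ(m)·N` (`ℕ`-valued, no `ε`, no `n²`); `GrowthHand φ` — every
admissible `β` carries, at every `β' > β`, families of SOME exponent `m_n ≥ 1` and nonscalar length
`N_n` with `φ(m_n)·N_n ≤ c·n^{β'}` (the exponent may grow with `n`, as fast as `φ` allows).

* `tensorRank_le_towerMultiplier_of_towerSupply` — THE UNIFORM TOWER BOUND: S1(m) (M22d's binder,
  verbatim) gives `ReadOut (2·3^{m-1}) m` on the nose (critic CLEARED g35, s1).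
* `familyRung_of_readOut` — `ReadOut φ m ⇒ FR(m)` (M21d currency, `C = φ m`).
* `growthHand_of_matrixMultiplication` — NEC: `ω = 2 ⇒ GrowthHand φ` for EVERY `φ` (`m = 1`).
* `multiplicityReduction_of_readOut_of_growthHand` — THE GROWTH-DIAL BRIDGE:
  `(∀ m ≥ 1, ReadOut φ m) ∧ GrowthHand φ ⇒ MultiplicityReduction`;
  `matrixMultiplication_iff_quadratic_growthHand_of_readOut` — then `ω = 2 ⟺ V ∧ GrowthHand φ`.
* `growthHand_of_bounded` — for a BOUNDED multiplier the hand is a THEOREM (Nullstellensatz: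
  `EqSystem.Correct.exists_uniform_generator_pow_mem`); so `multiplicityReduction_of_boundedReadOut`:
  a read-out with multiplier `O(1)` uniformly in the exponent would PROVE the crux, and
  `matrixMultiplication_iff_quadratic_of_boundedReadOut`: collapse the summit onto the residual `V`.
* `multiplicityReduction_of_logGapHand_of_towerSupply`,
  `matrixMultiplication_iff_quadratic_logGapHand_of_towerSupply` — the tower instance
  `φ(m) = 2·3^{m-1}`: given S1(m) for all `m ≥ 1`, `ω = 2 ⟺ V ∧ LGH` with the LOG-GAP HAND
  LGH = `GrowthHand (2·3^{m-1})` (NEC; `m` no longer fixed: exponent growth `≍ log₃` of the slack).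

Lens reading: the BRIDGE is `ReadOut φ`, its reach is `φ⁻¹(n^{slack})` — tower: `Θ(log n)`; a
polynomial `φ`: `n^{o(1)}`; a bounded `φ`: no hand needed.  Sources: NODE-g35/36; Leykin–Verschelde–
Zhao, TCS 359 (2006); Bürgisser–Clausen–Shokrollahi (1997) Prop. 15.1; Hilbert's Nullstellensatz.
No `sorry`.
-/


set_option linter.dupNamespace false

namespace Summit.MatrixMultiplication.MatrixMultiplication.Theorems.GraphEquations

open MvPolynomial
open Literature.Computability.AlgebraicComplexity
open Literature.Computability.AlgebraicComplexity.ArithCircuit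

/-! ## The uniform tower bound: `ReadOut (2·3^{m-1}) m ⟸ S1(m)` -/
/-- **UNIFORM TOWER BOUND.**  Given the generic-point supply S1(m) (the binder `hS1` of M22d
`familyRung_of_towerSupply`, verbatim), every exponent-`m` family of nonscalar length `≤ N` gives
`R(⟨n,n,n⟩) ≤ 2·3^{m-1}·N` — an `ℕ`-valued bound with the multiplier explicit. -/
theorem tensorRank_le_towerMultiplier_of_towerSupply {m : ℕ}
    (hS1 : ∀ n : ℕ, 1 ≤ n → ∀ (N T : ℕ) (t : Fin T → MvPolynomial (GraphVars n) ℂ),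
      (∀ o, t o ∈ graphIdeal n) →
      (∃ gs : List (MvPolynomial (GraphVars n) ℂ), IsNonscalarSeq gs ∧ gs.length ≤ N ∧
        ∀ o, t o ∈ freeSpan {q | q ∈ gs}) →
      (∀ q : Fin n × Fin n, generator n q ^ m ∈ Ideal.span (Set.range t)) →
      ∃ (a b c : ℕ) (θ₀ : GraphVars n → MvPolynomial (GraphVars n) ℂ)
        (Ds : List (Derivation ℂ (MvPolynomial (GraphVars n ⊕ Fin a) ℂ)
          (MvPolynomial (GraphVars n ⊕ Fin a) ℂ)))
        (word : Fin b → List (Derivation ℂ (MvPolynomial (GraphVars n ⊕ Fin a) ℂ)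
          (MvPolynomial (GraphVars n ⊕ Fin a) ℂ)))
        (θ₁ : GraphVars n ⊕ Fin a → MvPolynomial (GraphVars n ⊕ Fin a) ℂ)
        (τ : (Fin T × Fin b) ⊕ Fin c → MvPolynomial (GraphVars n ⊕ Fin a) ℂ)
        (Q : Fin a → MvPolynomial (MatMulVars n) ℂ)
        (P : Fin n × Fin n → (Fin T × Fin b) ⊕ Fin c → ℂ),
        Ds.length + 1 ≤ m ∧
        (∀ v, θ₀ v ∈ freeSpan (∅ : Set (MvPolynomial (GraphVars n) ℂ))) ∧
        (∀ D ∈ Ds, ∀ v, D (X v) ∈ freeSpan (∅ : Set (MvPolynomial (GraphVars n ⊕ Fin a) ℂ))) ∧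
        (∀ w, (word w).Sublist Ds) ∧
        (∀ v, θ₁ v ∈ freeSpan (∅ : Set (MvPolynomial (GraphVars n ⊕ Fin a) ℂ))) ∧
        (∀ ow : Fin T × Fin b, τ (Sum.inl ow) =
          bind₁ θ₁ ((word ow.2).foldl (fun acc D => D acc)
            (aeval (fun w : GraphVars n => (X (Sum.inl w) : MvPolynomial (GraphVars n ⊕ Fin a) ℂ))
              (aeval θ₀ (t ow.1))))) ∧
        (∀ x : Fin c, τ (Sum.inr x) ∈ freeSpan (∅ : Set (MvPolynomial (GraphVars n ⊕ Fin a) ℂ))) ∧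
        (∀ i, coeff 0 (Q i) = 0) ∧
        (∀ i (w : MatMulVars n), coeff (Finsupp.single w 1) (Q i) = 0) ∧
        (∀ o (i j j' l : Fin n),
          coeff (Finsupp.single (Sum.inl (i, j) : MatMulVars n) 1 +
              Finsupp.single (Sum.inr (j', l) : MatMulVars n) 1)
            (bind₁ (Sum.elim (fun v => graphRestrict n (X v)) Q) (τ o)) = 0) ∧
        (∀ q q' : Fin n × Fin n,
          ∑ o, P q o * coeff (Finsupp.single (Sum.inl (Sum.inr q') : GraphVars n ⊕ Fin a) 1) (τ o) =
            if q = q' then 1 else 0) ∧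
        (∀ (q : Fin n × Fin n) (i' : Fin a),
          ∑ o, P q o * coeff (Finsupp.single (Sum.inr i' : GraphVars n ⊕ Fin a) 1) (τ o) = 0)) :
    ∀ n : ℕ, 1 ≤ n → ∀ (N T : ℕ) (t : Fin T → MvPolynomial (GraphVars n) ℂ),
      (∀ o, t o ∈ graphIdeal n) →
      (∃ gs : List (MvPolynomial (GraphVars n) ℂ), IsNonscalarSeq gs ∧ gs.length ≤ N ∧
        ∀ o, t o ∈ freeSpan {q | q ∈ gs}) →
      (∀ q : Fin n × Fin n, generator n q ^ m ∈ Ideal.span (Set.range t)) →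
      tensorRank (matMulTensor ℂ n n n) ≤ 2 * 3 ^ (m - 1) * N := by
  intro n hn N T t ht hspan hmem
  obtain ⟨a, b, c, θ₀, Ds, word, θ₁, τ, Q, P, hk, hθ₀, hDs, hword, hθ₁, hτw, hτe, hQ0, hQ1, hsec,
    hPc, hPΛ⟩ := hS1 n hn N T t ht hspan hmem
  have hR : tensorRank (matMulTensor ℂ n n n) ≤ 2 * (3 ^ Ds.length * N) :=
    tensorRank_le_of_towerData t hspan θ₀ hθ₀ Ds hDs word hword θ₁ hθ₁ τ hτw hτe Q hQ0 hQ1 hsec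
      P hPc hPΛ
  have hpow : 3 ^ Ds.length ≤ 3 ^ (m - 1) := Nat.pow_le_pow_right (by norm_num) (by omega)
  calc tensorRank (matMulTensor ℂ n n n) ≤ 2 * (3 ^ Ds.length * N) := hR
    _ ≤ 2 * (3 ^ (m - 1) * N) := Nat.mul_le_mul_left _ (Nat.mul_le_mul_right _ hpow)
    _ = 2 * 3 ^ (m - 1) * N := by ring

/-- **`ReadOut φ m ⇒ FR(m)`** with `C = φ m` (and every `ε > 0`). -/
theorem familyRung_of_readOut (φ : ℕ → ℕ) {m : ℕ}
    (hRO : ∀ n : ℕ, 1 ≤ n → ∀ (N T : ℕ) (t : Fin T → MvPolynomial (GraphVars n) ℂ),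
      (∀ o, t o ∈ graphIdeal n) →
      (∃ gs : List (MvPolynomial (GraphVars n) ℂ), IsNonscalarSeq gs ∧ gs.length ≤ N ∧
        ∀ o, t o ∈ freeSpan {q | q ∈ gs}) →
      (∀ q : Fin n × Fin n, generator n q ^ m ∈ Ideal.span (Set.range t)) →
      tensorRank (matMulTensor ℂ n n n) ≤ φ m * N) :
    ∀ ε : ℝ, 0 < ε → ∃ C : ℝ, ∀ n : ℕ, 1 ≤ n → ∀ (N T : ℕ) (t : Fin T → MvPolynomial (GraphVars n) ℂ),
      (∀ o, t o ∈ graphIdeal n) →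
      (∃ gs : List (MvPolynomial (GraphVars n) ℂ), IsNonscalarSeq gs ∧ gs.length ≤ N ∧
        ∀ o, t o ∈ freeSpan {q | q ∈ gs}) →
      (∀ q : Fin n × Fin n, generator n q ^ m ∈ Ideal.span (Set.range t)) →
      (tensorRank (matMulTensor ℂ n n n) : ℝ) ≤ C * (n : ℝ) ^ ε * ((N : ℝ) + n * n) := by
  intro ε hε
  refine ⟨(φ m : ℝ), fun n hn N T t ht hspan hmem => ?_⟩
  have hR' : tensorRank (matMulTensor ℂ n n n) ≤ φ m * N := hRO n hn N T t ht hspan hmem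
  have hRr : (tensorRank (matMulTensor ℂ n n n) : ℝ) ≤ (φ m : ℝ) * (N : ℝ) := by
    exact_mod_cast hR'
  have hn1 : (1 : ℝ) ≤ n := by exact_mod_cast hn
  have hε1 : (1 : ℝ) ≤ (n : ℝ) ^ ε := Real.one_le_rpow hn1 hε.le
  have hN : (0 : ℝ) ≤ (N : ℝ) := Nat.cast_nonneg _
  have hK : (0 : ℝ) ≤ (φ m : ℝ) := Nat.cast_nonneg _
  calc (tensorRank (matMulTensor ℂ n n n) : ℝ) ≤ (φ m : ℝ) * (N : ℝ) := hRr
    _ ≤ (φ m : ℝ) * ((n : ℝ) ^ ε * ((N : ℝ) + n * n)) := by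
        refine mul_le_mul_of_nonneg_left ?_ hK
        calc (N : ℝ) = 1 * N := (one_mul _).symm
          _ ≤ (n : ℝ) ^ ε * ((N : ℝ) + n * n) :=
            mul_le_mul hε1 (by nlinarith [mul_self_nonneg (n : ℝ)]) hN (le_trans zero_le_one hε1)
    _ = (φ m : ℝ) * (n : ℝ) ^ ε * ((N : ℝ) + n * n) := by ring

/-- **NEC (absolute form)**: above `ω`, for every multiplier `φ`, families of exponent `1` and cost
`O(n^β)` — the test families of the generator systems (`exists_correct_generator_mem_of_omega_lt`). -/
theorem exists_growthFamily_of_omega_lt (φ : ℕ → ℕ) {β : ℝ} (hβ : omega ℂ < β) :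
    ∃ c : ℝ, ∀ n : ℕ, 1 ≤ n → ∃ (m N T : ℕ) (t : Fin T → MvPolynomial (GraphVars n) ℂ),
      1 ≤ m ∧ (∀ o, t o ∈ graphIdeal n) ∧
      (∃ gs : List (MvPolynomial (GraphVars n) ℂ), IsNonscalarSeq gs ∧ gs.length ≤ N ∧
        ∀ o, t o ∈ freeSpan {q | q ∈ gs}) ∧
      (∀ q : Fin n × Fin n, generator n q ^ m ∈ Ideal.span (Set.range t)) ∧
      (φ m : ℝ) * (N : ℝ) ≤ c * (n : ℝ) ^ β := by
  obtain ⟨c, hc⟩ := exists_correct_generator_mem_of_omega_lt hβ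
  refine ⟨(φ 1 : ℝ) * max c 0, fun n hn => ?_⟩
  obtain ⟨E, hE, hmem, hcost⟩ := hc n hn
  obtain ⟨gs, hns, hlen, hfs⟩ := exists_isNonscalarSeq_tests E hE.1
  refine ⟨1, E.cost, E.tests.length, fun o => E.testPoly (E.tests.get o), le_rfl,
    fun o => hE.testPoly_mem_graphIdeal' (List.get_mem E.tests o), ⟨gs, hns, hlen, hfs⟩, hmem, ?_⟩
  have hn0 : (0 : ℝ) ≤ (n : ℝ) ^ β := Real.rpow_nonneg (Nat.cast_nonneg _) _
  have h1 : (E.cost : ℝ) ≤ max c 0 * (n : ℝ) ^ β :=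
    hcost.trans (mul_le_mul_of_nonneg_right (le_max_left _ _) hn0)
  have hφ : (0 : ℝ) ≤ (φ 1 : ℝ) := Nat.cast_nonneg _
  calc (φ 1 : ℝ) * (E.cost : ℝ) ≤ (φ 1 : ℝ) * (max c 0 * (n : ℝ) ^ β) :=
        mul_le_mul_of_nonneg_left h1 hφ
    _ = (φ 1 : ℝ) * max c 0 * (n : ℝ) ^ β := by ring

/-- **NEC**: `ω = 2 ⇒ GrowthHand φ` for every multiplier `φ`. -/
theorem growthHand_of_matrixMultiplication (hS : _root_.MatrixMultiplication) (φ : ℕ → ℕ) :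
    ∀ β : ℝ, 2 ≤ β → EqAdmissible β → ∀ β' : ℝ, β < β' →
      ∃ c : ℝ, ∀ n : ℕ, 1 ≤ n → ∃ (m N T : ℕ) (t : Fin T → MvPolynomial (GraphVars n) ℂ),
        1 ≤ m ∧ (∀ o, t o ∈ graphIdeal n) ∧
        (∃ gs : List (MvPolynomial (GraphVars n) ℂ), IsNonscalarSeq gs ∧ gs.length ≤ N ∧
          ∀ o, t o ∈ freeSpan {q | q ∈ gs}) ∧
        (∀ q : Fin n × Fin n, generator n q ^ m ∈ Ideal.span (Set.range t)) ∧
        (φ m : ℝ) * (N : ℝ) ≤ c * (n : ℝ) ^ β' := by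
  intro β hβ _ β' hβ'
  have h2 : omega ℂ = 2 := hS
  exact exists_growthFamily_of_omega_lt φ (by rw [h2]; linarith)

/-- Above the growth hand's exponent, `ω` is bounded: `ReadOut φ` turns growth families of cost slack
`n^β` into rank bounds `R(⟨n,n,n⟩) = O(n^β)`. -/
theorem omega_le_of_readOut_of_growthFamilies (φ : ℕ → ℕ) {β : ℝ}
    (hRO : ∀ m : ℕ, 1 ≤ m → ∀ n : ℕ, 1 ≤ n → ∀ (N T : ℕ) (t : Fin T → MvPolynomial (GraphVars n) ℂ),
      (∀ o, t o ∈ graphIdeal n) →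
      (∃ gs : List (MvPolynomial (GraphVars n) ℂ), IsNonscalarSeq gs ∧ gs.length ≤ N ∧
        ∀ o, t o ∈ freeSpan {q | q ∈ gs}) →
      (∀ q : Fin n × Fin n, generator n q ^ m ∈ Ideal.span (Set.range t)) →
      tensorRank (matMulTensor ℂ n n n) ≤ φ m * N)
    (hfam : ∃ c : ℝ, ∀ n : ℕ, 1 ≤ n → ∃ (m N T : ℕ) (t : Fin T → MvPolynomial (GraphVars n) ℂ),
      1 ≤ m ∧ (∀ o, t o ∈ graphIdeal n) ∧
      (∃ gs : List (MvPolynomial (GraphVars n) ℂ), IsNonscalarSeq gs ∧ gs.length ≤ N ∧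
        ∀ o, t o ∈ freeSpan {q | q ∈ gs}) ∧
      (∀ q : Fin n × Fin n, generator n q ^ m ∈ Ideal.span (Set.range t)) ∧
      (φ m : ℝ) * (N : ℝ) ≤ c * (n : ℝ) ^ β) :
    omega ℂ ≤ β := by
  obtain ⟨c, hc⟩ := hfam
  refine omega_le_of_rank_family_le (K := max c 0) fun n hn => ?_
  obtain ⟨m, N, T, t, hm, hI, hspan, hmem, hcost⟩ := hc n hn
  have hR : tensorRank (matMulTensor ℂ n n n) ≤ φ m * N := hRO m hm n hn N T t hI hspan hmem
  have hRr : (tensorRank (matMulTensor ℂ n n n) : ℝ) ≤ (φ m : ℝ) * (N : ℝ) := by exact_mod_cast hR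
  have hn0 : (0 : ℝ) ≤ (n : ℝ) ^ β := Real.rpow_nonneg (Nat.cast_nonneg _) _
  exact hRr.trans (hcost.trans (mul_le_mul_of_nonneg_right (le_max_left _ _) hn0))

/-- **THE GROWTH-DIAL BRIDGE**: `(∀ m ≥ 1, ReadOut φ m) ∧ GrowthHand φ ⇒ MultiplicityReduction`. -/
theorem multiplicityReduction_of_readOut_of_growthHand (φ : ℕ → ℕ)
    (hRO : ∀ m : ℕ, 1 ≤ m → ∀ n : ℕ, 1 ≤ n → ∀ (N T : ℕ) (t : Fin T → MvPolynomial (GraphVars n) ℂ),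
      (∀ o, t o ∈ graphIdeal n) →
      (∃ gs : List (MvPolynomial (GraphVars n) ℂ), IsNonscalarSeq gs ∧ gs.length ≤ N ∧
        ∀ o, t o ∈ freeSpan {q | q ∈ gs}) →
      (∀ q : Fin n × Fin n, generator n q ^ m ∈ Ideal.span (Set.range t)) →
      tensorRank (matMulTensor ℂ n n n) ≤ φ m * N)
    (hH : ∀ β : ℝ, 2 ≤ β → EqAdmissible β → ∀ β' : ℝ, β < β' →
      ∃ c : ℝ, ∀ n : ℕ, 1 ≤ n → ∃ (m N T : ℕ) (t : Fin T → MvPolynomial (GraphVars n) ℂ),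
        1 ≤ m ∧ (∀ o, t o ∈ graphIdeal n) ∧
        (∃ gs : List (MvPolynomial (GraphVars n) ℂ), IsNonscalarSeq gs ∧ gs.length ≤ N ∧
          ∀ o, t o ∈ freeSpan {q | q ∈ gs}) ∧
        (∀ q : Fin n × Fin n, generator n q ^ m ∈ Ideal.span (Set.range t)) ∧
        (φ m : ℝ) * (N : ℝ) ≤ c * (n : ℝ) ^ β') :
    MultiplicityReduction := by
  intro β hβ hA βs hβs
  have hω : omega ℂ ≤ (β + βs) / 2 :=
    omega_le_of_readOut_of_growthFamilies φ hRO (hH β hβ hA ((β + βs) / 2) (by linarith))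
  exact eqAdmissibleRed_of_omega_lt (hω.trans_lt (by linarith))

/-- **Given the read-out, the summit splits as `V ∧ GrowthHand φ`** (both NEC). -/
theorem matrixMultiplication_iff_quadratic_growthHand_of_readOut (φ : ℕ → ℕ)
    (hRO : ∀ m : ℕ, 1 ≤ m → ∀ n : ℕ, 1 ≤ n → ∀ (N T : ℕ) (t : Fin T → MvPolynomial (GraphVars n) ℂ),
      (∀ o, t o ∈ graphIdeal n) →
      (∃ gs : List (MvPolynomial (GraphVars n) ℂ), IsNonscalarSeq gs ∧ gs.length ≤ N ∧
        ∀ o, t o ∈ freeSpan {q | q ∈ gs}) →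
      (∀ q : Fin n × Fin n, generator n q ^ m ∈ Ideal.span (Set.range t)) →
      tensorRank (matMulTensor ℂ n n n) ≤ φ m * N) :
    _root_.MatrixMultiplication ↔
      GraphEquationsQuadratic ∧
      (∀ β : ℝ, 2 ≤ β → EqAdmissible β → ∀ β' : ℝ, β < β' →
        ∃ c : ℝ, ∀ n : ℕ, 1 ≤ n → ∃ (m N T : ℕ) (t : Fin T → MvPolynomial (GraphVars n) ℂ),
          1 ≤ m ∧ (∀ o, t o ∈ graphIdeal n) ∧
          (∃ gs : List (MvPolynomial (GraphVars n) ℂ), IsNonscalarSeq gs ∧ gs.length ≤ N ∧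
            ∀ o, t o ∈ freeSpan {q | q ∈ gs}) ∧
          (∀ q : Fin n × Fin n, generator n q ^ m ∈ Ideal.span (Set.range t)) ∧
          (φ m : ℝ) * (N : ℝ) ≤ c * (n : ℝ) ^ β') := by
  constructor
  · intro hS
    exact ⟨nec_quadratic hS, growthHand_of_matrixMultiplication hS φ⟩
  · rintro ⟨hV, hH⟩
    exact matrixMultiplication_of_quadratic_of_multiplicityReduction hV
      (multiplicityReduction_of_readOut_of_growthHand φ hRO hH)

/-- **For a BOUNDED multiplier the growth hand is a theorem**: the test family of a correct system of
cost `O(n^β)` has SOME membership exponent (Hilbert's Nullstellensatz,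
`EqSystem.Correct.exists_uniform_generator_pow_mem`) and nonscalar length `≤ cost`. -/
theorem growthHand_of_bounded (φ : ℕ → ℕ) {C : ℕ} (hφ : ∀ m, φ m ≤ C) :
    ∀ β : ℝ, 2 ≤ β → EqAdmissible β → ∀ β' : ℝ, β < β' →
      ∃ c : ℝ, ∀ n : ℕ, 1 ≤ n → ∃ (m N T : ℕ) (t : Fin T → MvPolynomial (GraphVars n) ℂ),
        1 ≤ m ∧ (∀ o, t o ∈ graphIdeal n) ∧
        (∃ gs : List (MvPolynomial (GraphVars n) ℂ), IsNonscalarSeq gs ∧ gs.length ≤ N ∧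
          ∀ o, t o ∈ freeSpan {q | q ∈ gs}) ∧
        (∀ q : Fin n × Fin n, generator n q ^ m ∈ Ideal.span (Set.range t)) ∧
        (φ m : ℝ) * (N : ℝ) ≤ c * (n : ℝ) ^ β' := by
  intro β _ hA β' hβ'
  obtain ⟨c, hc⟩ := hA
  refine ⟨(C : ℝ) * max c 0, fun n hn => ?_⟩
  obtain ⟨E, hE, hcost⟩ := hc n hn
  obtain ⟨e, he, hmem⟩ := hE.exists_uniform_generator_pow_mem
  obtain ⟨gs, hns, hlen, hfs⟩ := exists_isNonscalarSeq_tests E hE.1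
  refine ⟨e, E.cost, E.tests.length, fun o => E.testPoly (E.tests.get o), he,
    fun o => hE.testPoly_mem_graphIdeal' (List.get_mem E.tests o), ⟨gs, hns, hlen, hfs⟩, hmem, ?_⟩
  have hn1 : (1 : ℝ) ≤ n := by exact_mod_cast hn
  have hββ' : (n : ℝ) ^ β ≤ (n : ℝ) ^ β' := Real.rpow_le_rpow_of_exponent_le hn1 hβ'.le
  have hn0 : (0 : ℝ) ≤ (n : ℝ) ^ β := Real.rpow_nonneg (Nat.cast_nonneg _) _
  have h1 : (E.cost : ℝ) ≤ max c 0 * (n : ℝ) ^ β' :=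
    hcost.trans ((mul_le_mul_of_nonneg_right (le_max_left _ _) hn0).trans
      (mul_le_mul_of_nonneg_left hββ' (le_max_right _ _)))
  have hφC : (φ e : ℝ) ≤ (C : ℝ) := by exact_mod_cast hφ e
  have hN : (0 : ℝ) ≤ (E.cost : ℝ) := Nat.cast_nonneg _
  calc (φ e : ℝ) * (E.cost : ℝ) ≤ (C : ℝ) * (E.cost : ℝ) := mul_le_mul_of_nonneg_right hφC hN
    _ ≤ (C : ℝ) * (max c 0 * (n : ℝ) ^ β') := mul_le_mul_of_nonneg_left h1 (Nat.cast_nonneg _)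
    _ = (C : ℝ) * max c 0 * (n : ℝ) ^ β' := by ring

/-- **A read-out with a multiplier bounded uniformly in the exponent PROVES the crux.** -/
theorem multiplicityReduction_of_boundedReadOut {C : ℕ}
    (hRO : ∀ m : ℕ, 1 ≤ m → ∀ n : ℕ, 1 ≤ n → ∀ (N T : ℕ) (t : Fin T → MvPolynomial (GraphVars n) ℂ),
      (∀ o, t o ∈ graphIdeal n) →
      (∃ gs : List (MvPolynomial (GraphVars n) ℂ), IsNonscalarSeq gs ∧ gs.length ≤ N ∧
        ∀ o, t o ∈ freeSpan {q | q ∈ gs}) →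
      (∀ q : Fin n × Fin n, generator n q ^ m ∈ Ideal.span (Set.range t)) →
      tensorRank (matMulTensor ℂ n n n) ≤ C * N) :
    MultiplicityReduction :=
  multiplicityReduction_of_readOut_of_growthHand (fun _ => C) hRO
    (growthHand_of_bounded (fun _ => C) fun _ => le_rfl)

/-- … and collapses the summit onto the residual `V`. -/
theorem matrixMultiplication_iff_quadratic_of_boundedReadOut {C : ℕ}
    (hRO : ∀ m : ℕ, 1 ≤ m → ∀ n : ℕ, 1 ≤ n → ∀ (N T : ℕ) (t : Fin T → MvPolynomial (GraphVars n) ℂ),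
      (∀ o, t o ∈ graphIdeal n) →
      (∃ gs : List (MvPolynomial (GraphVars n) ℂ), IsNonscalarSeq gs ∧ gs.length ≤ N ∧
        ∀ o, t o ∈ freeSpan {q | q ∈ gs}) →
      (∀ q : Fin n × Fin n, generator n q ^ m ∈ Ideal.span (Set.range t)) →
      tensorRank (matMulTensor ℂ n n n) ≤ C * N) :
    _root_.MatrixMultiplication ↔ GraphEquationsQuadratic :=
  ⟨nec_quadratic, fun hV => matrixMultiplication_of_quadratic_of_multiplicityReduction hV
    (multiplicityReduction_of_boundedReadOut hRO)⟩

/-! ## The tower instance: the log-gap hand LGH = `GrowthHand (2·3^{m-1})` -/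
/-- **THE DIAL WITH A MOVING EXPONENT, given S1(m) for every `m ≥ 1`**:
`LGH ⇒ MultiplicityReduction`, where LGH asks admissible exponents to carry, at every `β' > β`,
families of exponent `m_n` and nonscalar length `N_n` with `2·3^{m_n - 1}·N_n ≤ c·n^{β'}`. -/
theorem multiplicityReduction_of_logGapHand_of_towerSupply
    (hS1 : ∀ m : ℕ, 1 ≤ m → ∀ n : ℕ, 1 ≤ n → ∀ (N T : ℕ) (t : Fin T → MvPolynomial (GraphVars n) ℂ),
      (∀ o, t o ∈ graphIdeal n) →
      (∃ gs : List (MvPolynomial (GraphVars n) ℂ), IsNonscalarSeq gs ∧ gs.length ≤ N ∧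
        ∀ o, t o ∈ freeSpan {q | q ∈ gs}) →
      (∀ q : Fin n × Fin n, generator n q ^ m ∈ Ideal.span (Set.range t)) →
      ∃ (a b c : ℕ) (θ₀ : GraphVars n → MvPolynomial (GraphVars n) ℂ)
        (Ds : List (Derivation ℂ (MvPolynomial (GraphVars n ⊕ Fin a) ℂ)
          (MvPolynomial (GraphVars n ⊕ Fin a) ℂ)))
        (word : Fin b → List (Derivation ℂ (MvPolynomial (GraphVars n ⊕ Fin a) ℂ)
          (MvPolynomial (GraphVars n ⊕ Fin a) ℂ)))
        (θ₁ : GraphVars n ⊕ Fin a → MvPolynomial (GraphVars n ⊕ Fin a) ℂ)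
        (τ : (Fin T × Fin b) ⊕ Fin c → MvPolynomial (GraphVars n ⊕ Fin a) ℂ)
        (Q : Fin a → MvPolynomial (MatMulVars n) ℂ)
        (P : Fin n × Fin n → (Fin T × Fin b) ⊕ Fin c → ℂ),
        Ds.length + 1 ≤ m ∧
        (∀ v, θ₀ v ∈ freeSpan (∅ : Set (MvPolynomial (GraphVars n) ℂ))) ∧
        (∀ D ∈ Ds, ∀ v, D (X v) ∈ freeSpan (∅ : Set (MvPolynomial (GraphVars n ⊕ Fin a) ℂ))) ∧
        (∀ w, (word w).Sublist Ds) ∧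
        (∀ v, θ₁ v ∈ freeSpan (∅ : Set (MvPolynomial (GraphVars n ⊕ Fin a) ℂ))) ∧
        (∀ ow : Fin T × Fin b, τ (Sum.inl ow) =
          bind₁ θ₁ ((word ow.2).foldl (fun acc D => D acc)
            (aeval (fun w : GraphVars n => (X (Sum.inl w) : MvPolynomial (GraphVars n ⊕ Fin a) ℂ))
              (aeval θ₀ (t ow.1))))) ∧
        (∀ x : Fin c, τ (Sum.inr x) ∈ freeSpan (∅ : Set (MvPolynomial (GraphVars n ⊕ Fin a) ℂ))) ∧
        (∀ i, coeff 0 (Q i) = 0) ∧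
        (∀ i (w : MatMulVars n), coeff (Finsupp.single w 1) (Q i) = 0) ∧
        (∀ o (i j j' l : Fin n),
          coeff (Finsupp.single (Sum.inl (i, j) : MatMulVars n) 1 +
              Finsupp.single (Sum.inr (j', l) : MatMulVars n) 1)
            (bind₁ (Sum.elim (fun v => graphRestrict n (X v)) Q) (τ o)) = 0) ∧
        (∀ q q' : Fin n × Fin n,
          ∑ o, P q o * coeff (Finsupp.single (Sum.inl (Sum.inr q') : GraphVars n ⊕ Fin a) 1) (τ o) =
            if q = q' then 1 else 0) ∧
        (∀ (q : Fin n × Fin n) (i' : Fin a),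
          ∑ o, P q o * coeff (Finsupp.single (Sum.inr i' : GraphVars n ⊕ Fin a) 1) (τ o) = 0))
    (hL : ∀ β : ℝ, 2 ≤ β → EqAdmissible β → ∀ β' : ℝ, β < β' →
      ∃ c : ℝ, ∀ n : ℕ, 1 ≤ n → ∃ (m N T : ℕ) (t : Fin T → MvPolynomial (GraphVars n) ℂ),
        1 ≤ m ∧ (∀ o, t o ∈ graphIdeal n) ∧
        (∃ gs : List (MvPolynomial (GraphVars n) ℂ), IsNonscalarSeq gs ∧ gs.length ≤ N ∧
          ∀ o, t o ∈ freeSpan {q | q ∈ gs}) ∧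
        (∀ q : Fin n × Fin n, generator n q ^ m ∈ Ideal.span (Set.range t)) ∧
        ((2 * 3 ^ (m - 1) : ℕ) : ℝ) * (N : ℝ) ≤ c * (n : ℝ) ^ β') :
    MultiplicityReduction :=
  multiplicityReduction_of_readOut_of_growthHand (fun m => 2 * 3 ^ (m - 1))
    (fun m hm => tensorRank_le_towerMultiplier_of_towerSupply (hS1 m hm)) hL

/-- **Given S1(m) for every `m ≥ 1`: `ω = 2 ⟺ V ∧ LGH`.** -/
theorem matrixMultiplication_iff_quadratic_logGapHand_of_towerSupply
    (hS1 : ∀ m : ℕ, 1 ≤ m → ∀ n : ℕ, 1 ≤ n → ∀ (N T : ℕ) (t : Fin T → MvPolynomial (GraphVars n) ℂ),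
      (∀ o, t o ∈ graphIdeal n) →
      (∃ gs : List (MvPolynomial (GraphVars n) ℂ), IsNonscalarSeq gs ∧ gs.length ≤ N ∧
        ∀ o, t o ∈ freeSpan {q | q ∈ gs}) →
      (∀ q : Fin n × Fin n, generator n q ^ m ∈ Ideal.span (Set.range t)) →
      ∃ (a b c : ℕ) (θ₀ : GraphVars n → MvPolynomial (GraphVars n) ℂ)
        (Ds : List (Derivation ℂ (MvPolynomial (GraphVars n ⊕ Fin a) ℂ)
          (MvPolynomial (GraphVars n ⊕ Fin a) ℂ)))
        (word : Fin b → List (Derivation ℂ (MvPolynomial (GraphVars n ⊕ Fin a) ℂ)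
          (MvPolynomial (GraphVars n ⊕ Fin a) ℂ)))
        (θ₁ : GraphVars n ⊕ Fin a → MvPolynomial (GraphVars n ⊕ Fin a) ℂ)
        (τ : (Fin T × Fin b) ⊕ Fin c → MvPolynomial (GraphVars n ⊕ Fin a) ℂ)
        (Q : Fin a → MvPolynomial (MatMulVars n) ℂ)
        (P : Fin n × Fin n → (Fin T × Fin b) ⊕ Fin c → ℂ),
        Ds.length + 1 ≤ m ∧
        (∀ v, θ₀ v ∈ freeSpan (∅ : Set (MvPolynomial (GraphVars n) ℂ))) ∧
        (∀ D ∈ Ds, ∀ v, D (X v) ∈ freeSpan (∅ : Set (MvPolynomial (GraphVars n ⊕ Fin a) ℂ))) ∧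
        (∀ w, (word w).Sublist Ds) ∧
        (∀ v, θ₁ v ∈ freeSpan (∅ : Set (MvPolynomial (GraphVars n ⊕ Fin a) ℂ))) ∧
        (∀ ow : Fin T × Fin b, τ (Sum.inl ow) =
          bind₁ θ₁ ((word ow.2).foldl (fun acc D => D acc)
            (aeval (fun w : GraphVars n => (X (Sum.inl w) : MvPolynomial (GraphVars n ⊕ Fin a) ℂ))
              (aeval θ₀ (t ow.1))))) ∧
        (∀ x : Fin c, τ (Sum.inr x) ∈ freeSpan (∅ : Set (MvPolynomial (GraphVars n ⊕ Fin a) ℂ))) ∧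
        (∀ i, coeff 0 (Q i) = 0) ∧
        (∀ i (w : MatMulVars n), coeff (Finsupp.single w 1) (Q i) = 0) ∧
        (∀ o (i j j' l : Fin n),
          coeff (Finsupp.single (Sum.inl (i, j) : MatMulVars n) 1 +
              Finsupp.single (Sum.inr (j', l) : MatMulVars n) 1)
            (bind₁ (Sum.elim (fun v => graphRestrict n (X v)) Q) (τ o)) = 0) ∧
        (∀ q q' : Fin n × Fin n,
          ∑ o, P q o * coeff (Finsupp.single (Sum.inl (Sum.inr q') : GraphVars n ⊕ Fin a) 1) (τ o) =
            if q = q' then 1 else 0) ∧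
        (∀ (q : Fin n × Fin n) (i' : Fin a),
          ∑ o, P q o * coeff (Finsupp.single (Sum.inr i' : GraphVars n ⊕ Fin a) 1) (τ o) = 0)) :
    _root_.MatrixMultiplication ↔
      GraphEquationsQuadratic ∧
      (∀ β : ℝ, 2 ≤ β → EqAdmissible β → ∀ β' : ℝ, β < β' →
        ∃ c : ℝ, ∀ n : ℕ, 1 ≤ n → ∃ (m N T : ℕ) (t : Fin T → MvPolynomial (GraphVars n) ℂ),
          1 ≤ m ∧ (∀ o, t o ∈ graphIdeal n) ∧
          (∃ gs : List (MvPolynomial (GraphVars n) ℂ), IsNonscalarSeq gs ∧ gs.length ≤ N ∧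
            ∀ o, t o ∈ freeSpan {q | q ∈ gs}) ∧
          (∀ q : Fin n × Fin n, generator n q ^ m ∈ Ideal.span (Set.range t)) ∧
          ((2 * 3 ^ (m - 1) : ℕ) : ℝ) * (N : ℝ) ≤ c * (n : ℝ) ^ β') :=
  matrixMultiplication_iff_quadratic_growthHand_of_readOut (fun m => 2 * 3 ^ (m - 1))
    (fun m hm => tensorRank_le_towerMultiplier_of_towerSupply (hS1 m hm))

end Summit.MatrixMultiplication.MatrixMultiplication.Theorems.GraphEquations
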